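import Mathlib.LinearAlgebra.Projection
import HarnessLib

/-!
# A completely reducible family of operators with scalar commutant acts irreducibly
(folklore ∕ Curtis–Reiner §25: if every invariant subspace has an invariant complement and every equivariant endomorphism is a
scalar, there is no invariant subspace other than `⊥` and `⊤` — the projection onto an invariant complemented subspace along an
invariant complement is an equivariant idempotent, hence the scalar `0` or `1`)

For a set `S` of endomorphisms of a vector space `M` over a field `K`:
* **`eq_bot_or_eq_top_of_complemented_of_commutant_scalar`** — if every `S`-stable subspace has an `S`-stable complement and
  every endomorphism commuting with `S` is a scalar, then every `S`-stable subspace is `⊥` or `⊤`.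
* `eq_bot_or_eq_top_of_complemented_of_idempotent_trivial` — the same with «equivariant idempotents are `0` or `1`» (the form fed by
  a DIVISION-ALGEBRA commutant, `idempotent_trivial_of_commutant_division`: e.g. `End_Γ′ = D` a quaternion algebra).
Typed for the Hodge cell's crux K1Q, stub S4 (iii) of the line «mechanism-v2» (memo ROUTE-P3v27 (C24)(b), last step: Deligne
semisimplicity of a finite-index monodromy group (`Deligne1971_monodromy_semisimple`) + «equivariant endomorphisms = scalars» ⇒ strong
irreducibility of the quaternionic part). THEOREM only, any field. [cite: CurtisReiner1962, §25 (25.8)]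
-/

namespace Literature.Algebra.Module

variable {K : Type*} [Field K] {M : Type*} [AddCommGroup M] [Module K M]

/-- **Completely reducible + scalar commutant ⇒ irreducible.** `S ⊆ End M`; every `S`-stable subspace has an `S`-stable
complement; every endomorphism commuting with all of `S` is a scalar. Then an `S`-stable subspace `F` is `⊥` or `⊤`: the
projection onto `F` along a stable complement `F'` commutes with `S`, so equals `c • 1`; `c = 1` on `F ≠ 0` and `c = 0` on `F' ≠ 0`
cannot both hold. [cite: CurtisReiner1962, §25 (25.8)] -/
theorem eq_bot_or_eq_top_of_complemented_of_commutant_scalar (S : Set (Module.End K M))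
    (hcr : ∀ F : Submodule K M, (∀ s ∈ S, ∀ x ∈ F, s x ∈ F) →
      ∃ F' : Submodule K M, IsCompl F F' ∧ ∀ s ∈ S, ∀ x ∈ F', s x ∈ F')
    (hend : ∀ φ : Module.End K M, (∀ s ∈ S, φ * s = s * φ) → ∃ c : K, φ = c • 1)
    {F : Submodule K M} (hF : ∀ s ∈ S, ∀ x ∈ F, s x ∈ F) : F = ⊥ ∨ F = ⊤ := by
  classical
  obtain ⟨F', hFF', hF'⟩ := hcr F hF
  -- the projection onto `F` along `F'` commutes with `S`
  set π : Module.End K M := F.projection F' hFF' with hπ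
  have hπF : ∀ x ∈ F, π x = x := fun x hx => by
    rw [hπ, Submodule.projection_apply, Submodule.projectionOnto_apply_of_mem_left hFF' hx]
  have hπF' : ∀ x ∈ F', π x = 0 := fun x hx => by
    rw [hπ, Submodule.projection_apply, Submodule.projectionOnto_apply_of_mem_right hFF' hx, Submodule.coe_zero]
  have hcomm : ∀ s ∈ S, π * s = s * π := by
    intro s hs
    refine LinearMap.ext fun x => ?_
    rw [Module.End.mul_apply, Module.End.mul_apply]
    have hx := Submodule.projection_add_projection_eq_self hFF' x
    have hx₁ : F.projection F' hFF' x ∈ F := (F.projectionOnto F' hFF' x).2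
    have hx₂ : F'.projection F hFF'.symm x ∈ F' := (F'.projectionOnto F hFF'.symm x).2
    rw [← hx, map_add, map_add, hπF _ (hF s hs _ hx₁), hπF' _ (hF' s hs _ hx₂), add_zero, map_add, hπF _ hx₁, hπF' _ hx₂,
      add_zero]
  obtain ⟨c, hc⟩ := hend π hcomm
  by_cases hF0 : F = ⊥
  · exact Or.inl hF0
  · right
    by_contra hFtop
    have hF'0 : F' ≠ ⊥ := by
      intro h0
      apply hFtop
      have := hFF'.sup_eq_top
      rwa [h0, sup_bot_eq] at this
    obtain ⟨x, hxF, hx0⟩ := (Submodule.ne_bot_iff F).1 hF0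
    obtain ⟨y, hyF', hy0⟩ := (Submodule.ne_bot_iff F').1 hF'0
    have h1 : c • x = x := by
      have := hπF x hxF
      rwa [hc, LinearMap.smul_apply, Module.End.one_apply] at this
    have h2 : c • y = 0 := by
      have := hπF' y hyF'
      rwa [hc, LinearMap.smul_apply, Module.End.one_apply] at this
    have hc0 : c = 0 := (smul_eq_zero.1 h2).resolve_right hy0
    rw [hc0, zero_smul] at h1
    exact hx0 h1.symm

/-- **Completely reducible + no non-trivial equivariant idempotent ⇒ irreducible** (the form in which a DIVISION-ALGEBRA commutant
is used, e.g. «`End_Γ′ = D` a quaternion algebra» for the Hodge cell's stub S4): if every `S`-stable subspace has an `S`-stable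
complement and every idempotent endomorphism commuting with `S` is `0` or `1`, then every `S`-stable subspace is `⊥` or `⊤`.
[cite: CurtisReiner1962, §25 (25.8)] -/
theorem eq_bot_or_eq_top_of_complemented_of_idempotent_trivial (S : Set (Module.End K M))
    (hcr : ∀ F : Submodule K M, (∀ s ∈ S, ∀ x ∈ F, s x ∈ F) →
      ∃ F' : Submodule K M, IsCompl F F' ∧ ∀ s ∈ S, ∀ x ∈ F', s x ∈ F')
    (hidem : ∀ π : Module.End K M, (∀ s ∈ S, π * s = s * π) → π * π = π → π = 0 ∨ π = 1)
    {F : Submodule K M} (hF : ∀ s ∈ S, ∀ x ∈ F, s x ∈ F) : F = ⊥ ∨ F = ⊤ := by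
  classical
  obtain ⟨F', hFF', hF'⟩ := hcr F hF
  set π : Module.End K M := F.projection F' hFF' with hπ
  have hπF : ∀ x ∈ F, π x = x := fun x hx => by
    rw [hπ, Submodule.projection_apply, Submodule.projectionOnto_apply_of_mem_left hFF' hx]
  have hπF' : ∀ x ∈ F', π x = 0 := fun x hx => by
    rw [hπ, Submodule.projection_apply, Submodule.projectionOnto_apply_of_mem_right hFF' hx, Submodule.coe_zero]
  have hπmem : ∀ x, π x ∈ F := fun x => (F.projectionOnto F' hFF' x).2
  have hcomm : ∀ s ∈ S, π * s = s * π := by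
    intro s hs
    refine LinearMap.ext fun x => ?_
    rw [Module.End.mul_apply, Module.End.mul_apply]
    have hx := Submodule.projection_add_projection_eq_self hFF' x
    have hx₁ : F.projection F' hFF' x ∈ F := (F.projectionOnto F' hFF' x).2
    have hx₂ : F'.projection F hFF'.symm x ∈ F' := (F'.projectionOnto F hFF'.symm x).2
    rw [← hx, map_add, map_add, hπF _ (hF s hs _ hx₁), hπF' _ (hF' s hs _ hx₂), add_zero, map_add, hπF _ hx₁, hπF' _ hx₂,
      add_zero]
  have hidem' : π * π = π := LinearMap.ext fun x => by rw [Module.End.mul_apply, hπF _ (hπmem x)]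
  rcases hidem π hcomm hidem' with h0 | h1
  · left
    rw [eq_bot_iff]
    intro x hx
    rw [Submodule.mem_bot, ← hπF x hx, h0, LinearMap.zero_apply]
  · right
    rw [eq_top_iff]
    intro x _
    rw [← show π x = x by rw [h1, Module.End.one_apply]]
    exact hπmem x

/-- **A division-ring commutant has no non-trivial idempotents**: if every non-zero endomorphism commuting with `S` is invertible
(«`End_S(M)` is a division algebra», Schur), then every idempotent commuting with `S` is `0` or `1` — the hypothesis `hidem` of
`eq_bot_or_eq_top_of_complemented_of_idempotent_trivial`. [cite: CurtisReiner1962, §27 (27.3)] -/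
theorem idempotent_trivial_of_commutant_division (S : Set (Module.End K M))
    (hdiv : ∀ φ : Module.End K M, (∀ s ∈ S, φ * s = s * φ) → φ ≠ 0 → IsUnit φ) (π : Module.End K M)
    (hπ : ∀ s ∈ S, π * s = s * π) (hidem : π * π = π) : π = 0 ∨ π = 1 := by
  by_cases h0 : π = 0
  · exact Or.inl h0
  · right
    obtain ⟨u, hu⟩ := hdiv π hπ h0
    -- `π² = π` and `π` invertible ⇒ `π = 1`
    have : (u : Module.End K M) * ((u : Module.End K M) * ↑u⁻¹) = (u : Module.End K M) * ↑u⁻¹ := by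
      rw [← mul_assoc, hu, hidem]
    rwa [Units.mul_inv, mul_one, hu] at this

end Literature.Algebra.Module
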